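import Mathlib
import Summits.NavierStokesRegularity.NavierStokesRegularity.Theses.FrozenSignCascade
import Summits.NavierStokesRegularity.NavierStokesRegularity.Theses.TypeILiouville
import Summits.NavierStokesRegularity.NavierStokesRegularity.Theorems.FrozenSignCascadeEnvelopeBoundKato
import Summits.NavierStokesRegularity.NavierStokesRegularity.Theorems.TypeICertificateLadderNoBlowupToClayLemmas
import Literature.Analysis.FluidPDE.NSLerayHopfSereginEnergyProofs
import Literature.Analysis.FluidPDE.KatoFarFieldBound
import Literature.Analysis.FluidPDE.NSLerayExistenceR3Holds
import Literature.Analysis.FluidPDE.LerayLocalRegularH1Proofs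
import Literature.Analysis.FluidPDE.RusinSverakLeraySolutions
import HarnessLib

/-!
# Route FrozenSignCascade · crux `EnvelopeBound` (stmt-NavierStokesRegularity-1549): the crux is
  downstream of `NoBlowup` (stmt-NavierStokesRegularity-0054)

Support file for the crux item stmt-NavierStokesRegularity-1549 (`EnvelopeBound`, rank 2 of route
`FrozenSignCascade`); lands `--supports` that item (line `registered`, lead c5).

**What is proved.**

1. `katoMaximalTime_eq_top_of_noBlowup` — under `NoBlowup` (VERBATIM the signature of the target
   item stmt-NavierStokesRegularity-0054 = `TypeILiouville.TypeIliouvilleThesis`, shared by routes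
   TypeILiouville / StretchingWellBinding / IsobarTomography / ComplexFluxBarrier, and the
   hypothesis of the proved frame item `NoBlowupToClay`, stmt-0055): every Clay datum has Kato
   maximal time `T_max(ν, u₀) = ∞`. This is the contradiction branch of the tree's
   `typeICertificateLadder_noBlowupToClay_proof` (`TypeICertificateLadderNoBlowupToClay.lean`),
   isolated as a statement about the Kato maximal time (that theorem concludes only the Clay
   statement, which does not give back `T_max = ∞` for want of weak–strong uniqueness in
   Fefferman's class): a finite `T_max` carries a singular point of the maximal Kato solution
   (`lemarieRieusset_singular_point_of_blowup_holds`), while the patched Tao-class classical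
   representative on `[0, T_max)`, grafted with Leray's weak solution from `T_max` on, is a classical
   Leray–Hopf solution on `[0, T_max]` from the datum and so extends smoothly past `T_max` by
   `NoBlowup` — bounded near the singular point, contradiction. Proof text adapted from that file
   (same engines: `exists_isTaoSolutionOn_of_isKatoSolutionOn`,
   `exists_classical_of_isTaoSolutionOn_family`, `leray_existence_R3_holds`,
   `weak_strong_uniqueness_holds`, `IsLerayHopfOn.congr_ae_slices`,
   `eLpNorm_parabolicCylinder_eq_top_of_ae_eq`); nothing new is claimed.
2. `envelopeBound_of_noBlowup` (registered form `stub_envelopeBoundOfNoBlowup`) — hence, by the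
   landed `Kato.envelopeBound_of_katoMaximalTime_eq_top`, **`NoBlowup → EnvelopeBound`**: the crux
   is certified DOWNSTREAM of the programme's no-blow-up target stmt-0054.

**Consequence for the crux.** Kernel-checked chain
`stmt-0054 (NoBlowup) ⇒ T_max = ∞ for all Clay data ⇒ EnvelopeBound` (this file and
`FrozenSignCascadeEnvelopeBoundKato`), next to the normal form
`EnvelopeBound ⇔ no PM² overshoot before a finite T_max` (`Kato.envelopeBound_iff_katoFinite`):
the crux's open content is a fragment of the no-blow-up problem itself; conditional, credits
nothing toward closing the item.

References: J. Leray, Acta Math. 63 (1934) §§19–21, §31; T. Kato, Math. Z. 187 (1984), Thms. 1, 4;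
P. G. Lemarié-Rieusset (2016), Thm. 7.2, Prop. 12.3, Thm. 15.1 (C); J. C. Robinson, J. L. Rodrigo,
W. Sadowski (2016), Thm. 8.19.
-/

noncomputable section

set_option linter.dupNamespace false -- nested layout Summit.<S>.<Sub>, Sub = S (D-0017)

open Literature.Analysis.FluidPDE MeasureTheory Set Function Filter Topology Metric
open scoped ENNReal NNReal InnerProductSpace RealInnerProductSpace Laplacian

namespace Summit.NavierStokesRegularity.NavierStokesRegularity.Theorems.EnvelopeBound.Kato

-- adapted from Summits/NavierStokesRegularity/NavierStokesRegularity/Theorems/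
-- TypeICertificateLadderNoBlowupToClay.lean (`typeICertificateLadder_noBlowupToClay_proof`):
-- its finite-`T_max` branch, concluded as `T_max = ∞` instead of the Clay statement.
/-- **`NoBlowup` forces `T_max = ∞` for Clay data.** If every classical solution of the unforced
Navier–Stokes system on `ℝ³ × [0, T)` which is Leray–Hopf on `[0, T]` from a rapidly decaying datum
extends smoothly past `T` (the signature of item stmt-NavierStokesRegularity-0054), then for every
`ν > 0` and every smooth, divergence-free, rapidly decaying `u₀` the Kato maximal time
`katoMaximalTime ν u₀` is `∞`. [cite: LemarieRieusset2016, Thm. 15.1 (C) with Thm. 7.2 and Prop. 12.3] -/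
theorem katoMaximalTime_eq_top_of_noBlowup
    (hNB : ∀ (ν T : ℝ), 0 < ν → 0 < T → ∀ (u : ℝ → EuclideanSpace ℝ (Fin 3) → EuclideanSpace ℝ (Fin 3)) (p : ℝ → EuclideanSpace ℝ (Fin 3) → ℝ), Literature.Analysis.FluidPDE.IsClassicalNSSolutionOn (Set.Ico 0 T) ν 0 u p → Literature.Analysis.FluidPDE.IsLerayHopfOn T ν 0 (u 0) u → Literature.Analysis.FluidPDE.HasRapidSpatialDecay (u 0) → Literature.Analysis.FluidPDE.HasSmoothExtensionPast ν 0 u T)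
    {ν : ℝ} (hν : 0 < ν) {u₀ : EuclideanSpace ℝ (Fin 3) → EuclideanSpace ℝ (Fin 3)}
    (hsm : ContDiff ℝ (⊤ : ℕ∞) u₀) (hdiv : NSWave0.IsDivFree u₀) (hdec : HasRapidSpatialDecay u₀) :
    katoMaximalTime ν u₀ = ⊤ := by
  classical
  by_contra htop
  /- ### the datum: `H^∞`, `L²`, `L³`, weakly divergence free -/
  have hHk : ∀ n : ℕ, ∫⁻ x, ‖iteratedFDeriv ℝ n u₀ x‖ₑ ^ 2 < ⊤ :=
    hdec.lintegral_enorm_iteratedFDeriv_sq_lt_top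
  have hmeas0 : AEStronglyMeasurable u₀ volume := hsm.continuous.aestronglyMeasurable
  have hL2 : ∫⁻ x, ‖u₀ x‖ₑ ^ 2 < ⊤ := by
    refine lt_of_le_of_lt (le_of_eq (lintegral_congr fun x => ?_)) (hHk 0)
    rw [← ofReal_norm, ← ofReal_norm, norm_iteratedFDeriv_zero]
  have hu2 : MemLp u₀ 2 volume := ⟨hmeas0, eLpNorm_two_lt_top_of_lintegral_enorm_sq_lt_top hL2⟩
  obtain ⟨C₀, hC₀⟩ := hdec 0 0
  have hbd0 : ∀ x, ‖u₀ x‖ ≤ C₀ := fun x => by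
    have h := hC₀ x
    rwa [pow_zero, one_mul, norm_iteratedFDeriv_zero] at h
  have hu3 : MemLp u₀ 3 volume := by
    refine ⟨hmeas0, ?_⟩
    have h3 : eLpNorm u₀ 3 volume ^ 3 ≤ eLpNorm u₀ ⊤ volume * eLpNorm u₀ 2 volume ^ 2 :=
      eLpNorm_three_pow_le hmeas0
    have htop : eLpNorm u₀ ⊤ volume ≤ ENNReal.ofReal C₀ := eLpNorm_top_le_of_bound hbd0
    have hfin : eLpNorm u₀ ⊤ volume * eLpNorm u₀ 2 volume ^ 2 < ⊤ :=
      ENNReal.mul_lt_top (htop.trans_lt ENNReal.ofReal_lt_top)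
        (ENNReal.pow_lt_top hu2.eLpNorm_lt_top)
    by_contra hnot
    rw [not_lt, top_le_iff] at hnot
    rw [hnot, ENNReal.top_pow (by norm_num)] at h3
    exact absurd (h3.trans_lt hfin) (lt_irrefl _)
  have hdiv' : VectorCalculus.IsDivFree u₀ := fun x => hdiv x
  have hwdiv : IsWeaklyDivFree u₀ :=
    VectorCalculus.IsDivFree.isWeaklyDivFree_holds hdiv' (hsm.of_le (mod_cast le_top))
  have hTm0 : 0 < katoMaximalTime ν u₀ := katoMaximalTime_pos kato_local_holds hν hu3 hwdiv
  have htop' : katoMaximalTime ν u₀ < ⊤ := lt_top_iff_ne_top.2 htop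
  -- the maximal Kato solution `w` on `[0, T)`, `T = T_max`
  obtain ⟨w, hw⟩ := exists_isKatoSolutionOn_katoMaximalTime kato_unique_holds hν hTm0 htop'
  set T : ℝ := (katoMaximalTime ν u₀).toReal with hT_def
  have hT0 : 0 < T := ENNReal.toReal_pos hTm0.ne' htop'.ne
  have hofReal : ENNReal.ofReal T = katoMaximalTime ν u₀ := ENNReal.ofReal_toReal htop'.ne
  have hmax : ∀ T'' : ℝ, T < T'' → ∀ w' : ℝ → EuclideanSpace ℝ (Fin 3) → EuclideanSpace ℝ (Fin 3),
      ¬ IsKatoSolutionOn T'' ν u₀ w' :=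
    fun T'' hT'' w' => not_isKatoSolutionOn_of_katoMaximalTime_lt (by
      rw [← hofReal]
      exact (ENNReal.ofReal_lt_ofReal_iff (hT0.trans hT'')).2 hT'')
  -- its singular point `(T, x₁)`
  obtain ⟨x₁, hx₁⟩ := lemarieRieusset_singular_point_of_blowup_holds hν hT0 hu3 hwdiv hw hmax
  have hall : ∀ r : ℝ, 0 < r →
      eLpNorm (uncurry w) ⊤ (volume.restrict (parabolicCylinder r ((T : ℝ), x₁))) = ⊤ :=
    fun r hr => eLpNorm_top_parabolicCylinder_eq_top_of_small hT0 hx₁ hr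
  /- ### the classical representative on `[0, T)`: patched Tao-class solutions -/
  set Ts : ℕ → ℝ := fun n => T - T / ((n : ℝ) + 2) with hTs_def
  have hTs0 : ∀ n, 0 < Ts n := fun n => by
    have h1 : T / ((n : ℝ) + 2) < T := by
      rw [div_lt_iff₀ (by positivity)]
      nlinarith
    simp only [hTs_def]
    linarith
  have hTsT : ∀ n, Ts n < T := fun n => by
    have h1 : 0 < T / ((n : ℝ) + 2) := by positivity
    simp only [hTs_def]
    linarith
  have hcof : ∀ t < T, ∃ n, t < Ts n := fun t ht => by
    obtain ⟨n, hn⟩ := exists_nat_gt (T / (T - t))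
    refine ⟨n, ?_⟩
    have hpos : 0 < T - t := sub_pos.2 ht
    have h1 : T < ((n : ℝ) + 2) * (T - t) := by
      rw [div_lt_iff₀ hpos] at hn
      nlinarith
    have h2 : T / ((n : ℝ) + 2) < T - t := by
      rw [div_lt_iff₀ (by positivity)]
      linarith
    simp only [hTs_def]
    linarith
  have hex : ∀ n, ∃ (u : ℝ → EuclideanSpace ℝ (Fin 3) → EuclideanSpace ℝ (Fin 3))
      (p : ℝ → EuclideanSpace ℝ (Fin 3) → ℝ), IsTaoSolutionOn (Ts n) ν u₀ u p :=
    fun n => exists_isTaoSolutionOn_of_isKatoSolutionOn hν hsm hdiv hdec hw (hTs0 n) (hTsT n)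
  choose u p hup using hex
  obtain ⟨U, P, hcl, hU0, hUeq⟩ :=
    exists_classical_of_isTaoSolutionOn_family hν hTs0 (fun n => (hTsT n).le) hcof hup
  -- `U` agrees a.e. with the Kato solution `w` on every slice of `[0, T)`
  have hUw : ∀ t ∈ Ico 0 T, U t =ᵐ[volume] w t := by
    intro t ht
    obtain ⟨n, hn⟩ := hcof t ht.2
    rw [(hUeq n t ⟨ht.1, hn⟩).1]
    have hwn : IsKatoSolutionOn (Ts n) ν u₀ w := hw.mono (hTsT n).le
    exact (hup n).ae_eq_of_kato hν hwn.mild hwn.continuousInLpOn hwn.aestronglyMeasurable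
      t ⟨ht.1, hn⟩
  -- `U` is measurable on the strip
  have hUm : AEStronglyMeasurable (uncurry U) (volume.restrict (Ioo 0 T ×ˢ univ)) :=
    (hcl.smooth_velocity.continuousOn.mono
      (prod_mono Ioo_subset_Ico_self Subset.rfl)).aestronglyMeasurable
      (measurableSet_Ioo.prod MeasurableSet.univ)
  /- ### Leray's weak solution, grafted at `T` -/
  obtain ⟨v, hv⟩ := leray_existence_R3_holds ν hν u₀ hu2 hwdiv
  -- `v(t) = U(t)` a.e. for `0 < t < T` (Prodi–Serrin, through the Tao-class solutions)
  have hvU : ∀ t ∈ Ioo 0 T, v t =ᵐ[volume] U t := by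
    intro t ht
    obtain ⟨n, hn⟩ := hcof t ht.2
    rw [(hUeq n t ⟨ht.1.le, hn⟩).1]
    have hLH : IsLerayHopfOn (Ts n) ν 0 u₀ (u n) := (hup n).isLerayHopfOn (hTs0 n)
    obtain ⟨B, -, hB⟩ := (hup n).exists_bound_velocity
    have hSer : MemLqLp ⊤ ⊤ (u n) (Ioo 0 (Ts n)) :=
      memLqLp_top_top_of_bound (fun s hs => (hup n).aestronglyMeasurable_slice hs) hB
    exact weak_strong_uniqueness_holds hν (hTs0 n) hLH (q := ⊤) (r := ⊤) ENNReal.ofNat_lt_top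
      (by simp [ENNReal.div_top]) hSer (hv.isLerayHopfOn (hTs0 n)) t ⟨ht.1, hn.le⟩
  -- reset the unconstrained slice `v 0`
  set v' : ℝ → EuclideanSpace ℝ (Fin 3) → EuclideanSpace ℝ (Fin 3) :=
    fun t => if t = 0 then u₀ else v t with hv'_def
  have hLHv' : IsLerayHopfOn T ν 0 u₀ v' :=
    isLerayHopfOn_update_initial (hv.isLerayHopfOn hT0) hu2
  -- the grafted field
  set V : ℝ → EuclideanSpace ℝ (Fin 3) → EuclideanSpace ℝ (Fin 3) :=
    fun t => if t < T then U t else v t with hV_def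
  have hVlt : ∀ {t : ℝ}, t < T → V t = U t := fun {t} ht => by simp only [hV_def, if_pos ht]
  have hV0 : V 0 = u₀ := by rw [hVlt hT0, hU0]
  have hVm : AEStronglyMeasurable (uncurry V) (volume.restrict (Ioo 0 T ×ˢ univ)) := by
    refine hUm.congr ?_
    filter_upwards [ae_restrict_mem (measurableSet_Ioo.prod MeasurableSet.univ)] with z hz
    obtain ⟨t, x⟩ := z
    simp only [uncurry_apply_pair, hVlt (show t < T from hz.1.2)]
  have hVeq : ∀ t ∈ Icc 0 T, V t =ᵐ[volume] v' t := by
    intro t ht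
    rcases eq_or_lt_of_le ht.1 with h0 | hpos
    · subst h0
      rw [hV0]
      simp [hv'_def]
    have hv't : v' t = v t := by simp only [hv'_def, if_neg hpos.ne']
    rw [hv't]
    rcases lt_or_eq_of_le ht.2 with hlt | heq
    · rw [hVlt hlt]
      exact (hvU t ⟨hpos, hlt⟩).symm
    · subst heq
      simp only [hV_def, lt_irrefl, if_false]
      exact Filter.EventuallyEq.rfl
  have hLHV : IsLerayHopfOn T ν 0 u₀ V := hLHv'.congr_ae_slices hT0 hVm hVeq
  have hclV : IsClassicalNSSolutionOn (Ico 0 T) ν 0 V P :=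
    hcl.congr_slices (fun t ht => hVlt ht.2) fun t _ => rfl
  /- ### `NoBlowup` at the maximal time -/
  have hLHV' : IsLerayHopfOn T ν 0 (V 0) V := by
    rw [hV0]
    exact hLHV
  have hdecV : HasRapidSpatialDecay (V 0) := by
    rw [hV0]
    exact hdec
  obtain ⟨T', hTT', u', p', hcl', hagree⟩ := hNB ν T hν hT0 V P hclV hLHV' hdecV
  -- the continuation is bounded on the compact `[T/2, T] × B̄(x₁, 1)`
  set K : Set (ℝ × EuclideanSpace ℝ (Fin 3)) := Icc (T / 2) T ×ˢ closedBall x₁ 1 with hK_def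
  have hK : IsCompact K := isCompact_Icc.prod (isCompact_closedBall _ _)
  have hKsub : K ⊆ Ico 0 T' ×ˢ (univ : Set (EuclideanSpace ℝ (Fin 3))) :=
    prod_mono (fun t ht => ⟨by linarith [ht.1], ht.2.trans_lt hTT'⟩) (subset_univ _)
  have hcont : ContinuousOn (uncurry u') K := hcl'.smooth_velocity.continuousOn.mono hKsub
  obtain ⟨M, hM⟩ := hK.exists_bound_of_continuousOn hcont
  -- a small cylinder `Q_r(T, x₁) ⊆ K`, `r ≤ 1`, `r² ≤ T/2`
  set r : ℝ := min 1 (Real.sqrt (T / 2)) with hr_def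
  have hr0 : 0 < r := lt_min one_pos (Real.sqrt_pos.2 (by positivity))
  have hr1 : r ≤ 1 := min_le_left _ _
  have hr2 : r ^ 2 ≤ T / 2 := by
    calc r ^ 2 ≤ Real.sqrt (T / 2) ^ 2 := pow_le_pow_left₀ hr0.le (min_le_right _ _) 2
      _ = T / 2 := Real.sq_sqrt (by positivity)
  have hcylK : parabolicCylinder r ((T : ℝ), x₁) ⊆ K := by
    rintro ⟨s, y⟩ hz
    rw [mem_parabolicCylinder] at hz
    exact ⟨⟨by linarith [hz.1.1], hz.1.2.le⟩, mem_closedBall.2 (hz.2.le.trans hr1)⟩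
  -- on the cylinder `U = u'`, so `U` is essentially bounded there …
  have hbdU : eLpNorm (uncurry U) ⊤ (volume.restrict (parabolicCylinder r ((T : ℝ), x₁))) < ⊤ := by
    rw [eLpNorm_exponent_top]
    refine eLpNormEssSup_lt_top_of_ae_bound (C := M) ?_
    filter_upwards [ae_restrict_mem (isOpen_parabolicCylinder r ((T : ℝ), x₁)).measurableSet]
      with z hz
    have hzK := hcylK hz
    obtain ⟨s, y⟩ := z
    rw [mem_parabolicCylinder] at hz
    have hs : s ∈ Ico 0 T := ⟨by linarith [hz.1.1, hr2], hz.1.2⟩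
    have heq : uncurry U (s, y) = uncurry u' (s, y) := by
      simp only [uncurry_apply_pair, hagree s hs, hVlt hs.2]
    rw [heq]
    exact hM _ hzK
  -- … while the singularity of `w` at `(T, x₁)` transfers to `U`
  have hUw' : uncurry U =ᵐ[volume.restrict (Ioo 0 T ×ˢ (univ : Set (EuclideanSpace ℝ (Fin 3))))]
      uncurry w :=
    ae_restrict_prod_of_forall_ae_eq (fun t ht => hUw t ⟨ht.1.le, ht.2⟩) hUm
      hw.aestronglyMeasurable
  exact hbdU.ne (eLpNorm_parabolicCylinder_eq_top_of_ae_eq hT0 hUw' x₁ hall hr0)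

/-- **`NoBlowup → EnvelopeBound`**: the crux of route `FrozenSignCascade` follows from the
no-blow-up statement of item stmt-NavierStokesRegularity-0054 (`katoMaximalTime_eq_top_of_noBlowup`
and `Kato.envelopeBound_of_katoMaximalTime_eq_top`). [cite: LemarieRieusset2016, Thm. 15.1 (C) with Thm. 7.2] -/
theorem envelopeBound_of_noBlowup
    (hNB : ∀ (ν T : ℝ), 0 < ν → 0 < T → ∀ (u : ℝ → EuclideanSpace ℝ (Fin 3) → EuclideanSpace ℝ (Fin 3)) (p : ℝ → EuclideanSpace ℝ (Fin 3) → ℝ), Literature.Analysis.FluidPDE.IsClassicalNSSolutionOn (Set.Ico 0 T) ν 0 u p → Literature.Analysis.FluidPDE.IsLerayHopfOn T ν 0 (u 0) u → Literature.Analysis.FluidPDE.HasRapidSpatialDecay (u 0) → Literature.Analysis.FluidPDE.HasSmoothExtensionPast ν 0 u T) :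
    Theses.FrozenSignCascade.EnvelopeBound :=
  envelopeBound_of_katoMaximalTime_eq_top fun _ hν _ hu hdiv hd =>
    katoMaximalTime_eq_top_of_noBlowup hNB hν hu hdiv hd

/-- **Item form**: `EnvelopeBound` from the registered target decl of item
stmt-NavierStokesRegularity-0054 (`TypeILiouville.TypeIliouvilleThesis`, definitionally the
`NoBlowup` signature above). [cite: LemarieRieusset2016, Thm. 15.1 (C) with Thm. 7.2] -/
theorem envelopeBound_of_typeIliouvilleThesis
    (h : Theses.TypeILiouville.TypeIliouvilleThesis) :
    Theses.FrozenSignCascade.EnvelopeBound :=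
  envelopeBound_of_noBlowup h

/-! ### Registered form -/

/-- **Registered sub-goal `stub_envelopeBoundOfNoBlowup`** (crux stmt-NavierStokesRegularity-1549,
line `registered`, lead c5): `NoBlowup (stmt-0054) → EnvelopeBound`, in the form recorded on the
ledger. [cite: LemarieRieusset2016, Thm. 15.1 (C) with Thm. 7.2] -/
theorem stub_envelopeBoundOfNoBlowup : (∀ (ν T : ℝ), 0 < ν → 0 < T → ∀ (u : ℝ → EuclideanSpace ℝ (Fin 3) → EuclideanSpace ℝ (Fin 3)) (p : ℝ → EuclideanSpace ℝ (Fin 3) → ℝ), Literature.Analysis.FluidPDE.IsClassicalNSSolutionOn (Set.Ico 0 T) ν 0 u p → Literature.Analysis.FluidPDE.IsLerayHopfOn T ν 0 (u 0) u → Literature.Analysis.FluidPDE.HasRapidSpatialDecay (u 0) → Literature.Analysis.FluidPDE.HasSmoothExtensionPast ν 0 u T) → Summit.NavierStokesRegularity.NavierStokesRegularity.Theses.FrozenSignCascade.EnvelopeBound :=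
  envelopeBound_of_noBlowup

end Summit.NavierStokesRegularity.NavierStokesRegularity.Theorems.EnvelopeBound.Kato

end
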